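import Summits.HubbardSuperconductivity.HubbardSuperconductivity.Theorems.AnisotropyChordTransferFibre3Hole2Interval
import Summits.HubbardSuperconductivity.HubbardSuperconductivity.Theorems.AnisotropyChordTransferFibre3TorusDirichletDual
import Summits.HubbardSuperconductivity.HubbardSuperconductivity.Theorems.AnisotropyChordTransferFibre3RowDecomposition

/-!
# Route `AnisotropyChord` / H0 rotor rung: HOLE₂ per-`L` certificates — SOUNDNESS II: the Green's function enclosure

For `3 ≤ L`, `r₁, r₂ < L` and the certified constant `g_L = gFix L / D`, the fixed-point interval
`greenIv L (cosTab L) (einvTab L (cosTab L) (gFix L)) r₁ r₂` of the kernel checker (`…Fibre3Hole2Check`) contains the real number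
`Re G̃_{g_L}(r) = (1/L²) Σ_{k ≠ 0} cos(2π(k₁r₁ + k₂r₂)/L)/(ε(k) − g_L)` — p2's `TwoHoleBS.greenW` (`…Fibre3TorusDirichletDual`) read at
`r = ((r₁ : ZMod L), (r₂ : ZMod L))` — provided the positivity check `epsPos` passes (`mem_greenW`).  Ingredients: the double
`range` form of the `Tor L`-sum (`sum_tor_range`), the character's real part (`RateLemma.phase_re`) reduced mod `L`, and the row /
spine inductions `mem_gRow`, `mem_gSum` over the interval kit of `…Fibre3Hole2Interval`.
Prover seat `hubbard-h0-rotor-p3` g3; helper for stmt-HubbardSuperconductivity-19089 (`--supports`, helper class).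
WHAT THIS IS NOT: nothing here proves superconductivity in the Hubbard model (rotor TARGET as worded stays FALSE, g15 verdict);
soundness lemmas for the per-`L` HOLE₂ certificates of ONE conditional reduction (rung 19089). Mathlib + tree imports only; no sorry.
-/

set_option linter.dupNamespace false
set_option autoImplicit false

namespace Summit.HubbardSuperconductivity.HubbardSuperconductivity.Theorems.AnisotropyChord.Transfer.Fibre3

namespace Hole2

open scoped BigOperators
open Finset

/-! ## The real summand and the double `range` form of `Re G̃` -/

/-- `ε` at natural coordinates as a real function. [folklore] -/
noncomputable def epsN (L : ℕ) (k1 k2 : ℕ) : ℝ :=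
  2 - Real.cos (2 * Real.pi * k1 / L) - Real.cos (2 * Real.pi * k2 / L)

/-- the summand of `Re G̃_g(r)`: `0` at `k = 0`, else `cos(2π((k₁r₁ + k₂r₂) mod L)/L)/(ε(k) − g)`. [folklore] -/
noncomputable def gterm (L : ℕ) (g : ℝ) (r1 r2 k1 k2 : ℕ) : ℝ :=
  if k1 = 0 ∧ k2 = 0 then 0 else Real.cos (2 * Real.pi * ((k1 * r1 + k2 * r2) % L : ℕ) / L) / (epsN L k1 k2 - g)

/-- a `ZMod L`-indexed sum is a `range L` sum over the casts. [folklore] -/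
theorem sum_zmod_natCast (L : ℕ) [NeZero L] (F : ZMod L → ℝ) : ∑ a : ZMod L, F a = ∑ i ∈ range L, F (i : ZMod L) := by
  have h := RateLemma.sum_zmod_val L (fun i => F ((i : ℕ) : ZMod L))
  simp only [ZMod.natCast_zmod_val] at h
  exact h

/-- a `Tor L`-indexed sum is a double `range L` sum over the casts. [folklore] -/
theorem sum_tor_range (L : ℕ) [NeZero L] (F : Tor L → ℝ) :
    ∑ k : Tor L, F k = ∑ i ∈ range L, ∑ j ∈ range L, F (((i : ℕ) : ZMod L), ((j : ℕ) : ZMod L)) := by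
  rw [Fintype.sum_prod_type, sum_zmod_natCast]
  exact Finset.sum_congr rfl fun i _ => sum_zmod_natCast L _

/-- `cos(2πn/L) = cos(2π(n mod L)/L)`. [folklore] -/
theorem cos_mod (L : ℕ) (hL : 0 < L) (n : ℕ) :
    Real.cos (2 * Real.pi * n / L) = Real.cos (2 * Real.pi * ((n % L : ℕ) : ℝ) / L) := by
  have hLr : (L : ℝ) ≠ 0 := by exact_mod_cast (ne_of_gt hL)
  conv_lhs => rw [← Nat.mod_add_div n L]
  rw [show 2 * Real.pi * ((n % L + L * (n / L) : ℕ) : ℝ) / L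
      = 2 * Real.pi * ((n % L : ℕ) : ℝ) / L + ((n / L : ℕ) : ℝ) * (2 * Real.pi) by
    push_cast; field_simp]
  exact Real.cos_add_nat_mul_two_pi _ _

/-- a cast natural below `L` vanishes in `ZMod L` only if it is `0`. [folklore] -/
theorem natCast_zmod_eq_zero (L : ℕ) {i : ℕ} (hi : i < L) : ((i : ℕ) : ZMod L) = 0 ↔ i = 0 := by
  rw [ZMod.natCast_eq_zero_iff]
  constructor
  · intro h
    rcases Nat.eq_zero_or_pos i with h0 | h0
    · exact h0
    · exact absurd (Nat.le_of_dvd h0 h) (not_le.mpr hi)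
  · rintro rfl; exact dvd_zero _

/-- ★ the double `range` form of p2's Green's function: `Re G̃_g((r₁,r₂)) = (Σ_{k₁,k₂<L} gterm)/L²` (`r₁, r₂ < L`). [folklore] -/
theorem greenW_re_eq (L : ℕ) [NeZero L] (g : ℝ) {r1 r2 : ℕ} (h1 : r1 < L) (h2 : r2 < L) :
    (TwoHoleBS.greenW L g (((r1 : ℕ) : ZMod L), ((r2 : ℕ) : ZMod L))).re
      = (∑ k1 ∈ range L, ∑ k2 ∈ range L, gterm L g r1 r2 k1 k2) / (L : ℝ) ^ 2 := by
  have hL : 0 < L := Nat.pos_of_ne_zero (NeZero.ne L)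
  unfold TwoHoleBS.greenW
  rw [TwoHoleBS.div_V_re, Complex.re_sum]
  congr 1
  rw [sum_tor_range]
  refine Finset.sum_congr rfl fun k1 hk1 => Finset.sum_congr rfl fun k2 hk2 => ?_
  rw [Finset.mem_range] at hk1 hk2
  unfold gterm
  have hzero : ((((k1 : ℕ) : ZMod L), ((k2 : ℕ) : ZMod L)) : Tor L) = 0 ↔ (k1 = 0 ∧ k2 = 0) := by
    rw [Prod.mk_eq_zero, natCast_zmod_eq_zero L hk1, natCast_zmod_eq_zero L hk2]
  by_cases hk : k1 = 0 ∧ k2 = 0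
  · rw [if_pos (hzero.mpr hk), if_pos hk, Complex.zero_re]
  · rw [if_neg (fun h => hk (hzero.mp h)), if_neg hk, Complex.div_ofReal_re, RateLemma.phase_re]
    simp only [ZMod.val_natCast, Nat.mod_eq_of_lt hk1, Nat.mod_eq_of_lt hk2, Nat.mod_eq_of_lt h1, Nat.mod_eq_of_lt h2]
    rw [cos_mod L hL, epsT_natCast L hk1 hk2]
    rfl

/-! ## Table lookups for the reciprocal table -/

/-- row `k₁ < L` of `einvTab`. [folklore] -/
theorem einvTab_row {L : ℕ} (ct : List Iv) (g : ℤ) {k1 : ℕ} (hk1 : k1 < L) :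
    (einvTab L ct g).getD k1 [] = (List.range L).map fun k2 => iinv (epsIv ct g k1 k2) := by
  unfold einvTab
  exact getD_map_range _ _ hk1

/-- entry `(k₁, k₂)` of `einvTab`, `k₁, k₂ < L`. [folklore] -/
theorem getIv_einvTab {L : ℕ} (ct : List Iv) (g : ℤ) {k1 k2 : ℕ} (hk1 : k1 < L) (hk2 : k2 < L) :
    getIv ((einvTab L ct g).getD k1 []) k2 = iinv (epsIv ct g k1 k2) := by
  rw [einvTab_row ct g hk1]
  unfold getIv
  exact getD_map_range _ _ hk2

/-- the positivity check, unpacked: every `ε(k) − g`, `k ≠ 0`, has a positive fixed-point lower bound. [folklore] -/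
theorem epsPos_spec {L : ℕ} {ct : List Iv} {g : ℤ} (h : epsPos L ct g = true) {k1 k2 : ℕ} (hk1 : k1 < L) (hk2 : k2 < L)
    (hk : ¬ (k1 = 0 ∧ k2 = 0)) : 0 < (epsIv ct g k1 k2).1 := by
  unfold epsPos at h
  rw [List.all_eq_true] at h
  have h1 := h k1 (List.mem_range.mpr hk1)
  rw [List.all_eq_true] at h1
  have h2 := h1 k2 (List.mem_range.mpr hk2)
  rw [Bool.or_eq_true, Bool.and_eq_true, beq_iff_eq, beq_iff_eq, decide_eq_true_eq] at h2
  rcases h2 with h2 | h2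
  · exact absurd h2 hk
  · exact h2

/-! ## The enclosure of `Re G̃` -/

/-- each summand is enclosed: `gterm ∈ cos-interval × reciprocal-interval` (or `0`). [folklore] -/
theorem mem_gterm (L : ℕ) [NeZero L] (hL : 3 ≤ L) (hpos : epsPos L (cosTab L) (gFix L) = true) (r1 r2 : ℕ) {k1 k2 : ℕ}
    (hk1 : k1 < L) (hk2 : k2 < L) (hk : ¬ (k1 = 0 ∧ k2 = 0)) :
    mem (gterm L (gR L) r1 r2 k1 k2)
      (imul (getIv (cosTab L) ((k1 * r1 + k2 * r2) % L)) (getIv ((einvTab L (cosTab L) (gFix L)).getD k1 []) k2)) := by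
  have hL0 : 0 < L := by omega
  unfold gterm
  rw [if_neg hk, div_eq_mul_one_div]
  have hm : (k1 * r1 + k2 * r2) % L < L := Nat.mod_lt _ hL0
  rw [getIv_cosTab hm, getIv_einvTab _ _ hk1 hk2]
  refine mem_imul (mem_cosIv hL hm) (mem_iinv ?_ (epsPos_spec hpos hk1 hk2 hk))
  have := mem_epsIv L hL hk1 hk2
  rw [epsT_natCast L hk1 hk2] at this
  exact this

/-- row induction: the partial row sum `Σ_{k₂ < n}` is enclosed by `gRow … n` (`n ≤ L`). [folklore] -/
theorem mem_gRow (L : ℕ) [NeZero L] (hL : 3 ≤ L) (hpos : epsPos L (cosTab L) (gFix L) = true) (r1 r2 : ℕ) {k1 : ℕ}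
    (hk1 : k1 < L) : ∀ n : ℕ, n ≤ L →
      mem (∑ k2 ∈ range n, gterm L (gR L) r1 r2 k1 k2)
        (gRow L (cosTab L) ((einvTab L (cosTab L) (gFix L)).getD k1 []) r1 r2 k1 n) := by
  intro n
  induction n with
  | zero =>
    intro _
    rw [Finset.sum_range_zero]
    have := mem_exact 0
    push_cast at this
    rw [zero_div] at this
    exact this
  | succ n ih =>
    intro hn
    have hn' : n < L := hn
    rw [Finset.sum_range_succ]
    unfold gRow
    by_cases hk : k1 = 0 ∧ n = 0
    · rw [if_pos hk]
      have hz : gterm L (gR L) r1 r2 k1 n = 0 := by unfold gterm; rw [if_pos hk]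
      rw [hz, add_zero]
      exact ih (by omega)
    · rw [if_neg hk]
      exact mem_iadd (ih (by omega)) (mem_gterm L hL hpos r1 r2 hk1 hn' hk)

/-- spine induction: `Σ_{k₁ < n} Σ_{k₂ < L}` is enclosed by `gSum … n` (`n ≤ L`). [folklore] -/
theorem mem_gSum (L : ℕ) [NeZero L] (hL : 3 ≤ L) (hpos : epsPos L (cosTab L) (gFix L) = true) (r1 r2 : ℕ) :
    ∀ n : ℕ, n ≤ L →
      mem (∑ k1 ∈ range n, ∑ k2 ∈ range L, gterm L (gR L) r1 r2 k1 k2)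
        (gSum L (cosTab L) (einvTab L (cosTab L) (gFix L)) r1 r2 n) := by
  intro n
  induction n with
  | zero =>
    intro _
    rw [Finset.sum_range_zero]
    have := mem_exact 0
    push_cast at this
    rw [zero_div] at this
    exact this
  | succ n ih =>
    intro hn
    rw [Finset.sum_range_succ]
    unfold gSum
    exact mem_iadd (ih (by omega)) (mem_gRow L hL hpos r1 r2 (show n < L from hn) L le_rfl)

/-- ★ the Green's function enclosure: `Re G̃_{g_L}((r₁, r₂)) ∈ greenIv L (cosTab L) (einvTab …) r₁ r₂` (`r₁, r₂ < L`). [folklore] -/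
theorem mem_greenW (L : ℕ) [NeZero L] (hL : 3 ≤ L) (hpos : epsPos L (cosTab L) (gFix L) = true) {r1 r2 : ℕ}
    (h1 : r1 < L) (h2 : r2 < L) :
    mem (TwoHoleBS.greenW L (gR L) (((r1 : ℕ) : ZMod L), ((r2 : ℕ) : ZMod L))).re
      (greenIv L (cosTab L) (einvTab L (cosTab L) (gFix L)) r1 r2) := by
  rw [greenW_re_eq L (gR L) h1 h2]
  unfold greenIv
  have hLL : (0 : ℤ) < (L : ℤ) * L := by
    have : (0 : ℤ) < L := by exact_mod_cast (show 0 < L by omega)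
    positivity
  have h := mem_idivn (mem_gSum L hL hpos r1 r2 L le_rfl) hLL
  push_cast at h
  rw [sq]
  exact h

end Hole2

end Summit.HubbardSuperconductivity.HubbardSuperconductivity.Theorems.AnisotropyChord.Transfer.Fibre3
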